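import Summits.Ventures.LatticeQCDFlow.Scaling.GroundStateIdentities

/-!
HONEST FRAMING: exact (Metropolis-corrected) sampling algorithms for lattice gauge theory; figures
of merit are autocorrelation/cost numbers at stated couplings and volumes; no continuum-physics
claim.

# GroundStateShape — THE SHAPE OF A POSITIVE SOLUTION OF THE VERTEX EQUATIONS: EVERY COLD LEVEL HAS A STRICTLY SMALLER LISTED NEIGHBOUR, THE HOT LEVEL CARRIES THE MINIMUM,
# THE UNIVERSAL EDGE GRADIENT `|c_{i_r} − c_{l_r}| ≤ (mh/t)·c_0` ON EVERY LISTED PAIR (level-set flux + trace identity), `c_k ≤ (1 + n·mh/t)·c_0` ALONG A CHAIN OF `n` LISTED PAIRS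
# FROM THE HOT LEVEL, AND THE PARTICIPATION BOUND `Σ_kc_k/√(Σ_kc_k²) ≥ √(h/(ρ(1 + L·mh/t)))` WHEN EVERY LEVEL IS WITHIN `L` PAIRS OF THE HOT ONE (lean-2 GEN-48, ours)

Venture-side (OURS).  Cell `lqcd-flow` (pub-lqcd), unit `pub-lqcd-lean-2-g48`, 2026-08-31.  Chapter AI (the sizes of the Robin ground state), file 2 — Mathlib only (through file 1).
Setting: a swap list `e : Fin m → levels²`, rates `t/m` per entry and `h` at level `0`, and a POSITIVE solution `(c, ρ)`, `ρ > 0`, of chapter AH's vertex equations.  (§1) At a cold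
level `l ≠ 0` the equation reads `(t/m)Σ_{r∋l}(c_other − c_l) = −ρc_l < 0`: some listed neighbour is strictly smaller; hence a minimising level is the hot one — `c_0 = min_kc_k` (no
connectivity needed).  (§2) File 1's flux identity on the level set `A = {k : c_k > c_l}` (which misses `0`) has only non-negative edge terms and total `(m/t)ρΣ_Ac ≤ (m/t)ρΣc =
(m/t)hc_0` by the trace identity; the pair `(i, l)` itself is one of the terms, so `c_i − c_l ≤ (mh/t)c_0` for EVERY listed pair, whatever the topology.  (§3) Along a chain
`0 = γ_0 ~ γ_1 ~ ⋯ ~ γ_n` of listed pairs `c_{γ_n} ≤ (1 + n·mh/t)·c_0`; with every level within `L` pairs of `0`, `c_max ≤ (1 + L·mh/t)·c_0`.  (§4) `Σc² ≤ c_max·Σc`, so the floor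
statistic's participation `Σc/√(Σc²) ≥ √(Σc/c_max) ≥ √(h/(ρ(1 + L·mh/t)))` (trace identity again).  No definitions; no chain (Markov) in this file.

* §1 `groundState_hot_pos`, `groundState_exists_smaller_neighbour`, `groundState_hot_is_min`; §2 `groundState_sub_le_of_listed`, `groundState_edge_gradient`; §3 `groundState_chain_bound`,
  `groundState_le_of_reachable`; §4 `sum_sq_le_max_mul_sum`, `participation_ge_sqrt`, `groundState_participation_ge`.

Reading (no numerics implied): with chapter AH file 7 the ceiling's logarithm is `log(4Σc/c_min) = log(4h/ρ)` (file 1's trace identity with `c_min = c_0`), and the floor's statistic is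
informative as soon as `h/(ρ(1 + Lmh/t))` grows — for the path (`L = m = K`, `1/ρ ≍ K³/t`) it is `≍ K`.  Literature grade (cell rule): ELEMENTARY (discrete maximum principle, level-set
flux), NEW TYPING; nothing cited; no new bib keys.
-/

noncomputable section

open Finset

namespace Summit.Ventures.LatticeQCDFlow.Scaling

section Shape
variable {K m : ℕ} (e : Fin m → Fin (K + 1) × Fin (K + 1)) {t h ρ : ℝ} {c : Fin (K + 1) → ℝ}

/-! ## §1 The hot level carries the minimum -/

/-- For a positive solution with `ρ > 0` the hot rate is positive: `h = ρΣc/c_0 > 0`. [ours] -/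
theorem groundState_hot_pos (hρ : 0 < ρ) (hc : ∀ k, 0 < c k)
    (hvertex : ∀ k : Fin (K + 1), t / m * ∑ r : Fin m, ((if k = (e r).1 then c (e r).2 - c (e r).1 else 0) + (if k = (e r).2 then c (e r).1 - c (e r).2 else 0))
      - (if k = 0 then h * c k else 0) = -ρ * c k) :
    0 < h := by
  have htr := groundState_trace e hvertex
  have hS : 0 < ∑ k : Fin (K + 1), c k := by
    have : c 0 ≤ ∑ k : Fin (K + 1), c k := Finset.single_le_sum (fun k _ => (hc k).le) (mem_univ 0)
    linarith [hc 0]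
  have hprod : 0 < h * c 0 := by rw [← htr]; exact mul_pos hρ hS
  by_contra hh
  push Not at hh
  nlinarith [hc 0]

/-- **EVERY COLD LEVEL HAS A STRICTLY SMALLER LISTED NEIGHBOUR** (`m ≥ 1`, `t > 0`, `ρ > 0`, `c_l > 0`, `l ≠ 0`). [ours] -/
theorem groundState_exists_smaller_neighbour (hm : 1 ≤ m) (ht : 0 < t) (hρ : 0 < ρ)
    (hvertex : ∀ k : Fin (K + 1), t / m * ∑ r : Fin m, ((if k = (e r).1 then c (e r).2 - c (e r).1 else 0) + (if k = (e r).2 then c (e r).1 - c (e r).2 else 0))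
      - (if k = 0 then h * c k else 0) = -ρ * c k) {l : Fin (K + 1)} (hl : l ≠ 0) (hcl : 0 < c l) :
    ∃ r : Fin m, (l = (e r).1 ∧ c (e r).2 < c l) ∨ (l = (e r).2 ∧ c (e r).1 < c l) := by
  have hmpos : (0 : ℝ) < m := Nat.cast_pos.mpr (by omega)
  have hv := hvertex l
  rw [if_neg hl, sub_zero] at hv
  have hneg : ∑ r : Fin m, ((if l = (e r).1 then c (e r).2 - c (e r).1 else 0) + (if l = (e r).2 then c (e r).1 - c (e r).2 else 0)) < 0 := by
    by_contra hge
    push Not at hge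
    have h1 : 0 ≤ t / m * ∑ r : Fin m, ((if l = (e r).1 then c (e r).2 - c (e r).1 else 0) + (if l = (e r).2 then c (e r).1 - c (e r).2 else 0)) :=
      mul_nonneg (div_pos ht hmpos).le hge
    rw [hv] at h1
    nlinarith [mul_pos hρ hcl]
  have hex : ∃ r : Fin m, ((if l = (e r).1 then c (e r).2 - c (e r).1 else 0) + (if l = (e r).2 then c (e r).1 - c (e r).2 else 0)) < 0 := by
    by_contra hall
    push Not at hall
    exact absurd (sum_nonneg fun r _ => hall r) (not_le.mpr hneg)
  obtain ⟨r, hr⟩ := hex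
  refine ⟨r, ?_⟩
  by_cases h1 : l = (e r).1 <;> by_cases h2 : l = (e r).2
  · rw [if_pos h1, if_pos h2, ← h1, ← h2] at hr; linarith
  · rw [if_pos h1, if_neg h2, ← h1] at hr; exact Or.inl ⟨h1, by linarith⟩
  · rw [if_neg h1, if_pos h2, ← h2] at hr; exact Or.inr ⟨h2, by linarith⟩
  · rw [if_neg h1, if_neg h2] at hr; linarith

/-- **THE HOT LEVEL CARRIES THE MINIMUM: `c_0 ≤ c_k` for every `k`** (positive solution, `m ≥ 1`, `t > 0`, `ρ > 0`; no connectivity assumed). [ours] -/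
theorem groundState_hot_is_min (hm : 1 ≤ m) (ht : 0 < t) (hρ : 0 < ρ) (hc : ∀ k, 0 < c k)
    (hvertex : ∀ k : Fin (K + 1), t / m * ∑ r : Fin m, ((if k = (e r).1 then c (e r).2 - c (e r).1 else 0) + (if k = (e r).2 then c (e r).1 - c (e r).2 else 0))
      - (if k = 0 then h * c k else 0) = -ρ * c k) :
    ∀ k, c 0 ≤ c k := by
  obtain ⟨k₀, _, hk₀⟩ := exists_min_image univ c univ_nonempty
  by_cases h0 : k₀ = 0
  · subst h0; exact fun k => hk₀ k (mem_univ k)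
  · obtain ⟨r, hr⟩ := groundState_exists_smaller_neighbour e hm ht hρ hvertex h0 (hc k₀)
    rcases hr with ⟨_, hlt⟩ | ⟨_, hlt⟩
    · exact absurd (hk₀ _ (mem_univ _)) (not_le.mpr hlt)
    · exact absurd (hk₀ _ (mem_univ _)) (not_le.mpr hlt)

/-! ## §2 The universal edge gradient -/

/-- **THE LEVEL-SET FLUX BOUND on a listed pair:** if `(i, l)` is listed (in either orientation) then **`c_i − c_l ≤ (m·h/t)·c_0`** (positive solution, `ρ > 0`, `m ≥ 1`, `t > 0`).
Route: file 1's flux identity on `A = {k : c_l < c_k}` (`0 ∉ A` by §1) has non-negative edge terms summing to `(m/t)ρΣ_Ac ≤ (m/t)hc_0`. [ours] -/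
theorem groundState_sub_le_of_listed (hm : 1 ≤ m) (ht : 0 < t) (hρ : 0 < ρ) (hc : ∀ k, 0 < c k)
    (hvertex : ∀ k : Fin (K + 1), t / m * ∑ r : Fin m, ((if k = (e r).1 then c (e r).2 - c (e r).1 else 0) + (if k = (e r).2 then c (e r).1 - c (e r).2 else 0))
      - (if k = 0 then h * c k else 0) = -ρ * c k)
    {i l : Fin (K + 1)} (hil : ∃ r₀ : Fin m, ((e r₀).1 = i ∧ (e r₀).2 = l) ∨ ((e r₀).1 = l ∧ (e r₀).2 = i)) :
    c i - c l ≤ m * h / t * c 0 := by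
  have hmpos : (0 : ℝ) < m := Nat.cast_pos.mpr (by omega)
  have hh := groundState_hot_pos e hρ hc hvertex
  by_cases hle : c i ≤ c l
  · have : 0 ≤ m * h / t * c 0 := by have := hc 0; positivity
    linarith
  push Not at hle
  obtain ⟨r₀, hr₀⟩ := hil
  set A : Finset (Fin (K + 1)) := univ.filter fun k => c l < c k with hA
  have hmemA : ∀ k, k ∈ A ↔ c l < c k := fun k => by rw [hA, mem_filter]; exact ⟨fun h => h.2, fun h => ⟨mem_univ _, h⟩⟩
  have h0A : (0 : Fin (K + 1)) ∉ A := by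
    rw [hmemA]; push Not; exact groundState_hot_is_min e hm ht hρ hc hvertex l
  have hflux := groundState_flux e hvertex A
  rw [if_neg h0A, add_zero] at hflux
  -- every edge term is non-negative
  have hterms : ∀ r : Fin m, 0 ≤ (c (e r).1 - c (e r).2) * ((if (e r).1 ∈ A then (1 : ℝ) else 0) - (if (e r).2 ∈ A then (1 : ℝ) else 0)) := by
    intro r
    by_cases h1 : (e r).1 ∈ A <;> by_cases h2 : (e r).2 ∈ A
    · rw [if_pos h1, if_pos h2, sub_self, mul_zero]
    · rw [if_pos h1, if_neg h2]
      rw [hmemA] at h1 h2; push Not at h2; nlinarith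
    · rw [if_neg h1, if_pos h2]
      rw [hmemA] at h1 h2; push Not at h1; nlinarith
    · rw [if_neg h1, if_neg h2, sub_self, mul_zero]
  -- the term `r₀` is `c_i − c_l`
  have hiA : i ∈ A := (hmemA i).mpr hle
  have hlA : l ∉ A := by rw [hmemA]; exact lt_irrefl _
  have hr₀' : (c (e r₀).1 - c (e r₀).2) * ((if (e r₀).1 ∈ A then (1 : ℝ) else 0) - (if (e r₀).2 ∈ A then (1 : ℝ) else 0)) = c i - c l := by
    rcases hr₀ with ⟨h1, h2⟩ | ⟨h1, h2⟩
    · rw [h1, h2, if_pos hiA, if_neg hlA]; ring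
    · rw [h1, h2, if_neg hlA, if_pos hiA]; ring
  have hsingle : c i - c l ≤ ∑ r : Fin m, (c (e r).1 - c (e r).2) * ((if (e r).1 ∈ A then (1 : ℝ) else 0) - (if (e r).2 ∈ A then (1 : ℝ) else 0)) := by
    rw [← hr₀']; exact Finset.single_le_sum (fun r _ => hterms r) (mem_univ r₀)
  -- `ρΣ_Ac ≤ ρΣc = hc_0`
  have hAsum : ∑ k ∈ A, c k ≤ ∑ k : Fin (K + 1), c k := sum_le_univ_sum_of_nonneg fun k => (hc k).le
  have htr := groundState_trace e hvertex
  have hρA : ρ * ∑ k ∈ A, c k ≤ h * c 0 := by rw [← htr]; exact mul_le_mul_of_nonneg_left hAsum hρ.le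
  -- assemble: `c_i − c_l ≤ Σ terms = (m/t)ρΣ_Ac ≤ (m/t)hc_0`
  have hsumeq : ∑ r : Fin m, (c (e r).1 - c (e r).2) * ((if (e r).1 ∈ A then (1 : ℝ) else 0) - (if (e r).2 ∈ A then (1 : ℝ) else 0)) = m / t * (ρ * ∑ k ∈ A, c k) := by
    rw [← hflux]; field_simp
  rw [hsumeq] at hsingle
  calc c i - c l ≤ m / t * (ρ * ∑ k ∈ A, c k) := hsingle
    _ ≤ m / t * (h * c 0) := mul_le_mul_of_nonneg_left hρA (by positivity)
    _ = m * h / t * c 0 := by ring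

/-- **THE UNIVERSAL EDGE GRADIENT: `|c_{i_r} − c_{l_r}| ≤ (m·h/t)·c_0` on every listed pair, whatever the topology.** [ours] -/
theorem groundState_edge_gradient (hm : 1 ≤ m) (ht : 0 < t) (hρ : 0 < ρ) (hc : ∀ k, 0 < c k)
    (hvertex : ∀ k : Fin (K + 1), t / m * ∑ r : Fin m, ((if k = (e r).1 then c (e r).2 - c (e r).1 else 0) + (if k = (e r).2 then c (e r).1 - c (e r).2 else 0))
      - (if k = 0 then h * c k else 0) = -ρ * c k) (r : Fin m) :
    |c (e r).1 - c (e r).2| ≤ m * h / t * c 0 := by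
  rw [abs_le]
  constructor
  · have := groundState_sub_le_of_listed e hm ht hρ hc hvertex (i := (e r).2) (l := (e r).1) ⟨r, Or.inr ⟨rfl, rfl⟩⟩
    linarith
  · exact groundState_sub_le_of_listed e hm ht hρ hc hvertex ⟨r, Or.inl ⟨rfl, rfl⟩⟩

/-! ## §3 Chains from the hot level -/

/-- **ALONG A CHAIN OF LISTED PAIRS FROM THE HOT LEVEL: `c_{γ_j} ≤ (1 + j·mh/t)·c_0`** (`γ_0 = 0`, consecutive levels listed in either orientation). [ours] -/
theorem groundState_chain_bound (hm : 1 ≤ m) (ht : 0 < t) (hρ : 0 < ρ) (hc : ∀ k, 0 < c k)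
    (hvertex : ∀ k : Fin (K + 1), t / m * ∑ r : Fin m, ((if k = (e r).1 then c (e r).2 - c (e r).1 else 0) + (if k = (e r).2 then c (e r).1 - c (e r).2 else 0))
      - (if k = 0 then h * c k else 0) = -ρ * c k)
    {n : ℕ} (γ : Fin (n + 1) → Fin (K + 1)) (hγ0 : γ 0 = 0)
    (hγ : ∀ j : Fin n, ∃ r : Fin m, ((e r).1 = γ j.castSucc ∧ (e r).2 = γ j.succ) ∨ ((e r).1 = γ j.succ ∧ (e r).2 = γ j.castSucc)) :
    ∀ j : Fin (n + 1), c (γ j) ≤ (1 + (j : ℝ) * (m * h / t)) * c 0 := by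
  intro j
  induction j using Fin.induction with
  | zero => rw [hγ0]; simp
  | succ j ih =>
    have hstep : c (γ j.succ) - c (γ j.castSucc) ≤ m * h / t * c 0 := by
      refine groundState_sub_le_of_listed e hm ht hρ hc hvertex ?_
      obtain ⟨r, hr⟩ := hγ j
      exact ⟨r, hr.symm⟩
    have hcoe : ((j.succ : Fin (n + 1)) : ℝ) = (j.castSucc : Fin (n + 1)) + 1 := by
      rw [Fin.val_succ, Fin.val_castSucc]; push_cast; ring
    rw [hcoe]
    linarith

/-- **ECCENTRICITY BOUND: if every level is joined to the hot one by a chain of at most `L` listed pairs, then `c_k ≤ (1 + L·mh/t)·c_0` for every `k`.** [ours] -/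
theorem groundState_le_of_reachable (hm : 1 ≤ m) (ht : 0 < t) (hρ : 0 < ρ) (hc : ∀ k, 0 < c k)
    (hvertex : ∀ k : Fin (K + 1), t / m * ∑ r : Fin m, ((if k = (e r).1 then c (e r).2 - c (e r).1 else 0) + (if k = (e r).2 then c (e r).1 - c (e r).2 else 0))
      - (if k = 0 then h * c k else 0) = -ρ * c k) (L : ℕ)
    (hreach : ∀ k : Fin (K + 1), ∃ n : ℕ, n ≤ L ∧ ∃ γ : Fin (n + 1) → Fin (K + 1), γ 0 = 0 ∧ γ (Fin.last n) = k ∧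
      ∀ j : Fin n, ∃ r : Fin m, ((e r).1 = γ j.castSucc ∧ (e r).2 = γ j.succ) ∨ ((e r).1 = γ j.succ ∧ (e r).2 = γ j.castSucc)) :
    ∀ k, c k ≤ (1 + (L : ℝ) * (m * h / t)) * c 0 := by
  intro k
  obtain ⟨n, hnL, γ, hγ0, hγk, hγ⟩ := hreach k
  have hb := groundState_chain_bound e hm ht hρ hc hvertex γ hγ0 hγ (Fin.last n)
  rw [hγk, Fin.val_last] at hb
  have hh := groundState_hot_pos e hρ hc hvertex
  have hq : 0 ≤ m * h / t := by positivity
  have hnL' : (n : ℝ) ≤ L := Nat.cast_le.mpr hnL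
  calc c k ≤ (1 + (n : ℝ) * (m * h / t)) * c 0 := hb
    _ ≤ (1 + (L : ℝ) * (m * h / t)) * c 0 := by
        refine mul_le_mul_of_nonneg_right ?_ (hc 0).le
        nlinarith

/-! ## §4 Participation -/

omit e in
/-- `Σc² ≤ c_max·Σc` for `0 ≤ c ≤ c_max`. [ours] -/
theorem sum_sq_le_max_mul_sum {cmax : ℝ} (hc0 : ∀ k, 0 ≤ c k) (hle : ∀ k, c k ≤ cmax) :
    ∑ k : Fin (K + 1), c k ^ 2 ≤ cmax * ∑ k : Fin (K + 1), c k := by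
  rw [mul_sum]
  exact sum_le_sum fun k _ => by rw [pow_two]; exact mul_le_mul_of_nonneg_right (hle k) (hc0 k)

omit e in
/-- **Participation from a sup bound: `√(Σc/c_max) ≤ Σc/√(Σc²)`** (`0 < c ≤ c_max`). [ours] -/
theorem participation_ge_sqrt {cmax : ℝ} (hc : ∀ k, 0 < c k) (hle : ∀ k, c k ≤ cmax) :
    Real.sqrt ((∑ k : Fin (K + 1), c k) / cmax) ≤ (∑ k : Fin (K + 1), c k) / Real.sqrt (∑ k : Fin (K + 1), c k ^ 2) := by
  have hS : 0 < ∑ k : Fin (K + 1), c k := by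
    have : c 0 ≤ ∑ k : Fin (K + 1), c k := Finset.single_le_sum (fun k _ => (hc k).le) (mem_univ 0)
    linarith [hc 0]
  have hS2 : 0 < ∑ k : Fin (K + 1), c k ^ 2 := by
    have : c 0 ^ 2 ≤ ∑ k : Fin (K + 1), c k ^ 2 := Finset.single_le_sum (fun k _ => sq_nonneg (c k)) (mem_univ 0)
    nlinarith [hc 0]
  have hcmax : 0 < cmax := lt_of_lt_of_le (hc 0) (hle 0)
  have hsq := sum_sq_le_max_mul_sum (fun k => (hc k).le) hle
  have hkey : (∑ k : Fin (K + 1), c k) / cmax ≤ (∑ k : Fin (K + 1), c k) ^ 2 / ∑ k : Fin (K + 1), c k ^ 2 := by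
    rw [div_le_div_iff₀ hcmax hS2]; nlinarith
  calc Real.sqrt ((∑ k : Fin (K + 1), c k) / cmax) ≤ Real.sqrt ((∑ k : Fin (K + 1), c k) ^ 2 / ∑ k : Fin (K + 1), c k ^ 2) := Real.sqrt_le_sqrt hkey
    _ = (∑ k : Fin (K + 1), c k) / Real.sqrt (∑ k : Fin (K + 1), c k ^ 2) := by rw [Real.sqrt_div (sq_nonneg _), Real.sqrt_sq hS.le]

/-- **THE PARTICIPATION OF THE GROUND STATE: `√(h/(ρ(1 + L·mh/t))) ≤ Σ_kc_k/√(Σ_kc_k²)`** when every level is within `L` listed pairs of the hot one (trace identity + §3). [ours] -/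
theorem groundState_participation_ge (hm : 1 ≤ m) (ht : 0 < t) (hρ : 0 < ρ) (hc : ∀ k, 0 < c k)
    (hvertex : ∀ k : Fin (K + 1), t / m * ∑ r : Fin m, ((if k = (e r).1 then c (e r).2 - c (e r).1 else 0) + (if k = (e r).2 then c (e r).1 - c (e r).2 else 0))
      - (if k = 0 then h * c k else 0) = -ρ * c k) (L : ℕ)
    (hreach : ∀ k : Fin (K + 1), ∃ n : ℕ, n ≤ L ∧ ∃ γ : Fin (n + 1) → Fin (K + 1), γ 0 = 0 ∧ γ (Fin.last n) = k ∧
      ∀ j : Fin n, ∃ r : Fin m, ((e r).1 = γ j.castSucc ∧ (e r).2 = γ j.succ) ∨ ((e r).1 = γ j.succ ∧ (e r).2 = γ j.castSucc)) :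
    Real.sqrt (h / (ρ * (1 + (L : ℝ) * (m * h / t)))) ≤ (∑ k : Fin (K + 1), c k) / Real.sqrt (∑ k : Fin (K + 1), c k ^ 2) := by
  have hh := groundState_hot_pos e hρ hc hvertex
  have hmax := groundState_le_of_reachable e hm ht hρ hc hvertex L hreach
  have htr := groundState_trace e hvertex
  have hq : 0 < 1 + (L : ℝ) * (m * h / t) := by positivity
  have hratio : h / (ρ * (1 + (L : ℝ) * (m * h / t))) = (∑ k : Fin (K + 1), c k) / ((1 + (L : ℝ) * (m * h / t)) * c 0) := by
    rw [div_eq_div_iff (mul_pos hρ hq).ne' (mul_pos hq (hc 0)).ne']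
    calc h * ((1 + (L : ℝ) * (m * h / t)) * c 0) = (h * c 0) * (1 + (L : ℝ) * (m * h / t)) := by ring
      _ = (ρ * ∑ k : Fin (K + 1), c k) * (1 + (L : ℝ) * (m * h / t)) := by rw [htr]
      _ = (∑ k : Fin (K + 1), c k) * (ρ * (1 + (L : ℝ) * (m * h / t))) := by ring
  rw [hratio]
  exact participation_ge_sqrt hc hmax

end Shape

end Summit.Ventures.LatticeQCDFlow.Scaling

end
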